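import Literature.MathematicalPhysics.QuantumLattice.HubbardFreeKineticLowerBound
import HarnessLib

/-!
# The free-fermion (`U = 0`) ground-state energy of the half-filled Hubbard model: exact value on
# every even torus and in the two-dimensional thermodynamic limit (`e(t, 0, 1) = -16|t|/π²`)

Topic `MathematicalPhysics/QuantumLattice`, family `hubbard`. Written by the literature seat of the
folded cell `pub-mbboot` / speedrun `sr-mbsolver` (certified many-body solver; HONEST FRAMING: first
certified bounds; not a superconductivity verdict; every number certified or labelled float). The
cell's comparison tables carry the `U = 0` free-fermion values as CONTROLS ("a `U = 0` certificate
excluding them is a pipeline bug") and as orientation values; the tree had the exact free-fermion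
energy of the CHAIN in the thermodynamic limit (`FreeFermionChain.hubbardChainEnergyDensityAt_zero`)
and of the finite TORI for explicit Fermi seas (`FreeFermionTorus.hubbardTorus_groundEnergyAt_zero_eq`),
but for the square lattice in the thermodynamic limit only the two inequalities
(`FreeKinetic.energyDensity2D_ge`, `HartreeFock.energyDensity2D_le_freeFermion`). This file closes the
half-filled case:

* §1 `sdwBand_cellCorner_add_centerIndex` — for EVEN `L` the half-shift `z ↦ z + (L/2,…,L/2)` of the
  momentum grid `(ℤ/Lℤ)^d` flips the sign of every plane-wave level
  `ε_z = 2t Σᵢ cos (c_z)ᵢ` (`sdwBand t (cellCorner z)`, `c_z = 2πz/L - (π,…,π)`): the bipartite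
  (particle–hole) symmetry of the band, `ε_{k+(π,…,π)} = -ε_k`.
* §2 **`hubbardTorus_groundEnergyAt_zero_half_eq`** — on the torus `(ℤ/Lℤ)^d`, `L ≥ 3` even, every
  `d`, every real `t`: the HALF-FILLED free ground-state energy is EXACTLY
  `E_L(L^d)(t, 0) = 2 Σ_z min(ε_z, 0) = -Σ_z |ε_z|` (`…_eq_neg_sum_abs`). Upper bound = the
  plane-wave Slater determinant with `S↑ = {ε ≤ 0}`, `S↓ = {ε < 0}` (the tree's
  `HartreeFock.hubbardTorus_groundEnergyAt_le_freeFermion_momentum`, [BachLiebSolovej1994 (2c.36)]);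
  that `|S↑| + |S↓| = L^d` is the half-shift bijection `{ε < 0} ≃ {ε > 0}` of §1; lower bound = the
  tree's bathtub bound at `μ = 0` (`FreeKinetic.hubbardTorus_groundEnergyAt_ge`, [LiebLoss1993 §8]).
* §3 **`energyDensity2D_zero_one_eq_integral`** — in the thermodynamic limit on the square lattice,
  `e(t, 0, 1) = 2 (2π)⁻² ∫_{[-π,π]²} min(2t(cos p₁ + cos p₂), 0) dp`: lower bound = the tree's
  `FreeKinetic.energyDensity2D_ge` at `μ = 0`; upper bound = the tiling bound
  `ThermodynamicLimit.energyDensity2D_le` ([Ruelle1969 §3.3]) on the even tori of §2, whose exact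
  energies per site are corner Riemann sums of the continuous function `min(ε, 0)`
  (`tendsto_cornerRiemannSum`, [FriedliVelenikSMLS2017 §10.5.2]).
* §4 **`energyDensity2D_zero_one`** — the closed form `e(t, 0, 1) = -16|t|/π²`
  (`= -(4/π)² |t| ≈ -1.6211 |t|`), from the elementary quadrature
  `∫_{[-π,π]²} min(cos x + cos y, 0) dx dy = -16` (`integral_square_min_cos_add_cos`; for fixed `x`
  the integrand is `cos x + cos y` on `|y| ≥ π - |x|` and `0` elsewhere). This is the textbook value
  of the half-filled square-lattice tight-binding band [folklore] (the chain analogue `-4|t|/π` is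
  [cite: LiebWuPhysicaA2003, §6], in the tree as `FreeFermionChain.hubbardChainEnergyDensity_zero`);
  the nearest-neighbour spin correlation `-6/π⁴` used as the `U = 0` orientation value in the cell's
  tables is `-(3/2)(e/8t)²`.

Everything is PROVED; no definitions, no named facts.

## Mathlib / tree search

Tree (REUSED): `HartreeFock.hubbardTorus_groundEnergyAt_le_freeFermion_momentum`,
`FreeKinetic.hubbardTorus_groundEnergyAt_ge`, `FreeKinetic.energyDensity2D_ge`,
`ThermodynamicLimit.energyDensity2D_le`, `groundEnergyAt_fermionTorusGraph_two`,
`HartreeFock.sum_cellCorner_div_eq`, `HartreeFock.siteBand_neg_ofTorusSite(_eq_sdwBand)`,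
`sdwBand`, `cellCorner`, `centerIndex`, `cellCorner_add_centerIndex`, `latticeMomentum_eq_cellCorner_add`,
`cornerRiemannSum`, `tendsto_cornerRiemannSum`, `brillouin`. Mathlib: `Finset.card_bij`,
`Equiv.sum_comp`, `Real.cos_add_int_mul_two_pi`, `ge_of_tendsto`,
`tendsto_const_div_atTop_nhds_zero_nat`, `MeasureTheory.volume_preserving_finTwoArrow`,
`MeasureTheory.setIntegral_prod`, `intervalIntegral.integral_eq_sub_of_hasDerivAt`.
`lean search '16 / π ^ 2|energyDensity2D t 0|energyDensity2D_zero'`: not in the tree.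

## References

* E. H. Lieb, M. Loss, Duke Math. J. 71 (1993) 337, §8 (bathtub / sum of negative eigenvalues).
  [LiebLoss1993]
* V. Bach, E. H. Lieb, J. P. Solovej, J. Stat. Phys. 76 (1994) 3, eq. (2c.36). [BachLiebSolovej1994]
* D. Ruelle, *Statistical Mechanics: Rigorous Results* (1969), §3.3 (thermodynamic limit by tiling).
  [Ruelle1969]
* S. Friedli, Y. Velenik, *Statistical Mechanics of Lattice Systems* (CUP 2017), §10.5.2 (momentum
  sums → integrals). [FriedliVelenikSMLS2017]
* J. E. Hirsch, Phys. Rev. B 31 (1985) 4403, §II eq. (2.2): `ε_k = -2t(cos k_x + cos k_y)`, "the ground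
  state for the noninteracting system is obtained by filling the negative energy states" (read in the
  reprint volume A. Montorsi (ed.), *The Hubbard Model*, World Scientific, p. 217ff). [Hirsch1985]
* E. H. Lieb, F. Y. Wu, Physica A 321 (2003) 1, §6 (the one-dimensional value `-4t/π`). [LiebWuPhysicaA2003]
-/

noncomputable section

namespace Literature.MathematicalPhysics.QuantumLattice

namespace FreeFermionSquare

open Finset Filter Topology MeasureTheory Literature.Probability.LatticeModels
  Literature.MathematicalPhysics.QuantumLattice.LangerMattis
  Literature.MathematicalPhysics.QuantumLattice.HartreeFock
  Literature.MathematicalPhysics.QuantumLattice.FreeKinetic ThermodynamicLimit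
open scoped Topology

/-! ### §1 The half-shift (particle–hole) symmetry of the plane-wave levels on an even grid -/

section Torus

variable {d L : ℕ} [NeZero L]

/-- For even `L`, shifting the grid index by `j₀ = (L/2,…,L/2)` flips every cosine:
`cos (c_{z+j₀})ᵢ = -cos (c_z)ᵢ` (`c_{z+j₀} = 2πz/L` up to periods, and `2πz/L = c_z + π`). [folklore] -/
private theorem cos_cellCorner_add_centerIndex_apply (hL : Even L) (z : TorusSite d L) (i : Fin d) :
    Real.cos (cellCorner (z + centerIndex d L) i) = -Real.cos (cellCorner z i) := by
  obtain ⟨q, hq⟩ := cellCorner_add_centerIndex hL z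
  rw [hq]
  dsimp only
  rw [show latticeMomentum L z i + 2 * Real.pi * (q i : ℝ) =
      latticeMomentum L z i + (q i : ℝ) * (2 * Real.pi) by ring,
    Real.cos_add_int_mul_two_pi, latticeMomentum_eq_cellCorner_add]
  simp only [Pi.add_apply, Real.cos_add_pi]

/-- **Particle–hole symmetry of the band on an even torus**: `ε(c_{z+j₀}) = -ε(c_z)`,
`ε(p) = 2tΣᵢcos pᵢ = sdwBand t p` (the nesting vector `(π,…,π)` of the bipartite lattice maps the band
onto minus itself; Hirsch, §II after eq. (2.2)). [cite: Hirsch1985, §II, eq. (2.2)] -/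
theorem sdwBand_cellCorner_add_centerIndex (hL : Even L) (t : ℝ) (z : TorusSite d L) :
    sdwBand t (cellCorner (z + centerIndex d L)) = -sdwBand t (cellCorner z) := by
  simp only [sdwBand, cos_cellCorner_add_centerIndex_apply hL, Finset.sum_neg_distrib, mul_neg]

/-- The half shift is a bijection `{ε < 0} ≃ {ε > 0}` of the grid, so the two sets have the same
cardinality. [folklore] -/
private theorem card_filter_sdwBand_neg_eq_card_filter_pos (hL : Even L) (t : ℝ) :
    (univ.filter (fun z : TorusSite d L => sdwBand t (cellCorner z) < 0)).card =
      (univ.filter (fun z : TorusSite d L => 0 < sdwBand t (cellCorner z))).card := by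
  refine Finset.card_bij (fun z _ => z + centerIndex d L) ?_ ?_ ?_
  · intro z hz
    simp only [Finset.mem_filter, Finset.mem_univ, true_and] at hz ⊢
    rw [sdwBand_cellCorner_add_centerIndex hL]
    linarith
  · intro a _ b _ h
    exact add_right_cancel h
  · intro w hw
    refine ⟨w - centerIndex d L, ?_, sub_add_cancel w _⟩
    simp only [Finset.mem_filter, Finset.mem_univ, true_and] at hw ⊢
    have h := sdwBand_cellCorner_add_centerIndex hL t (w - centerIndex d L)
    rw [sub_add_cancel] at h
    linarith

/-- The grid `(ℤ/Lℤ)^d` has `L^d` points. [folklore] -/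
private theorem card_torusSite : Fintype.card (TorusSite d L) = L ^ d := by
  rw [Fintype.card_pi, prod_const, ZMod.card, card_univ, Fintype.card_fin]

/-- For even `L`: `#{ε ≤ 0} + #{ε < 0} = L^d` (since `#{ε < 0} = #{ε > 0}`). [folklore] -/
private theorem card_filter_nonpos_add_card_filter_neg (hL : Even L) (t : ℝ) :
    (univ.filter (fun z : TorusSite d L => sdwBand t (cellCorner z) ≤ 0)).card +
      (univ.filter (fun z : TorusSite d L => sdwBand t (cellCorner z) < 0)).card = L ^ d := by
  rw [card_filter_sdwBand_neg_eq_card_filter_pos hL t]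
  have h := Finset.card_filter_add_card_filter_not
    (s := (univ : Finset (TorusSite d L))) (fun z => sdwBand t (cellCorner z) ≤ 0)
  have h2 : (univ.filter fun z : TorusSite d L => ¬ sdwBand t (cellCorner z) ≤ 0) =
      univ.filter (fun z : TorusSite d L => 0 < sdwBand t (cellCorner z)) :=
    Finset.filter_congr fun z _ => not_le
  rw [h2, Finset.card_univ, card_torusSite] at h
  exact h

/-- `Σ_{ε ≤ 0} ε = Σ_z min(ε_z, 0)`. [folklore] -/
private theorem sum_filter_nonpos_eq_sum_min (f : TorusSite d L → ℝ) :
    ∑ z ∈ univ.filter (fun z => f z ≤ 0), f z = ∑ z, min (f z) 0 := by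
  rw [Finset.sum_filter]
  refine Finset.sum_congr rfl fun z _ => ?_
  by_cases h : f z ≤ 0
  · rw [if_pos h, min_eq_left h]
  · rw [if_neg h, min_eq_right (le_of_lt (not_le.mp h))]

/-- `Σ_{ε < 0} ε = Σ_z min(ε_z, 0)`. [folklore] -/
private theorem sum_filter_neg_eq_sum_min (f : TorusSite d L → ℝ) :
    ∑ z ∈ univ.filter (fun z => f z < 0), f z = ∑ z, min (f z) 0 := by
  rw [Finset.sum_filter]
  refine Finset.sum_congr rfl fun z _ => ?_
  by_cases h : f z < 0
  · rw [if_pos h, min_eq_left h.le]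
  · rw [if_neg h, min_eq_right (not_lt.mp h)]

/-- `min(a, 0) + min(-a, 0) = -|a|`. [folklore] -/
private theorem min_zero_add_min_neg_zero (a : ℝ) : min a 0 + min (-a) 0 = -|a| := by
  rcases le_total 0 a with h | h
  · rw [min_eq_right h, min_eq_left (neg_nonpos.mpr h), abs_of_nonneg h, zero_add]
  · rw [min_eq_left h, min_eq_right (neg_nonneg.mpr h), abs_of_nonpos h, add_zero, neg_neg]

/-- For even `L`: `2 Σ_z min(ε_z, 0) = -Σ_z |ε_z|` (reindex one copy by the half shift). [folklore] -/
private theorem two_mul_sum_min_sdwBand_eq_neg_sum_abs (hL : Even L) (t : ℝ) :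
    2 * ∑ z : TorusSite d L, min (sdwBand t (cellCorner z)) 0 =
      -∑ z : TorusSite d L, |sdwBand t (cellCorner z)| := by
  have hre : ∑ z : TorusSite d L, min (sdwBand t (cellCorner z)) 0 =
      ∑ z : TorusSite d L, min (-sdwBand t (cellCorner z)) 0 := by
    rw [← Equiv.sum_comp (Equiv.addRight (centerIndex d L))
      (fun z : TorusSite d L => min (sdwBand t (cellCorner z)) 0)]
    simp only [Equiv.coe_addRight, sdwBand_cellCorner_add_centerIndex hL]
  calc 2 * ∑ z : TorusSite d L, min (sdwBand t (cellCorner z)) 0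
      = ∑ z : TorusSite d L, min (sdwBand t (cellCorner z)) 0 +
          ∑ z : TorusSite d L, min (-sdwBand t (cellCorner z)) 0 := by rw [two_mul, ← hre]
    _ = ∑ z : TorusSite d L, -|sdwBand t (cellCorner z)| := by
          rw [← Finset.sum_add_distrib]
          exact Finset.sum_congr rfl fun z _ => min_zero_add_min_neg_zero _
    _ = -∑ z : TorusSite d L, |sdwBand t (cellCorner z)| := Finset.sum_neg_distrib _

/-! ### §2 The half-filled free torus: `E_L(L^d)(t, 0) = 2 Σ_z min(ε_z, 0) = -Σ_z |ε_z|` -/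

/-- The plane-wave hopping energy in the tree's momentum convention is the level read at the grid
corner: `-(t · 2Σᵢcos(2πzᵢ/L)) = sdwBand t (c_z)`. [folklore] -/
private theorem neg_hopping_eq_sdwBand_cellCorner (t : ℝ) (z : TorusSite d L) :
    -(t * (2 * ∑ i, Real.cos (latticeMomentum L z i))) = sdwBand t (cellCorner z) := by
  rw [← siteBand_neg_ofTorusSite, siteBand_neg_ofTorusSite_eq_sdwBand]

/-- **Upper half** (even `L ≥ 3`, all `d`, all real `t`): `E_L(L^d)(t, 0) ≤ 2 Σ_z min(ε_z, 0)` — the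
energy of the plane-wave Slater determinant filling `S↑ = {ε ≤ 0}` and `S↓ = {ε < 0}`, which has
exactly `L^d` particles by the half-shift symmetry. [cite: BachLiebSolovej1994, eq. (2c.36)] -/
theorem hubbardTorus_groundEnergyAt_zero_half_le (hL3 : 3 ≤ L) (hL : Even L) (t : ℝ) :
    groundEnergyAt (fermionTorusGraph d L) t 0 (L ^ d) ≤
      2 * ∑ z : TorusSite d L, min (sdwBand t (cellCorner z)) 0 := by
  classical
  have h := hubbardTorus_groundEnergyAt_le_freeFermion_momentum (d := d) hL3 t 0
    (univ.filter (fun z : TorusSite d L => sdwBand t (cellCorner z) ≤ 0))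
    (univ.filter (fun z : TorusSite d L => sdwBand t (cellCorner z) < 0))
  rw [card_filter_nonpos_add_card_filter_neg hL t] at h
  have e1 : ∀ S : Finset (TorusSite d L),
      -(∑ k ∈ S, t * (2 * ∑ i, Real.cos (latticeMomentum L k i))) =
        ∑ k ∈ S, sdwBand t (cellCorner k) := by
    intro S
    rw [← Finset.sum_neg_distrib]
    exact Finset.sum_congr rfl fun k _ => neg_hopping_eq_sdwBand_cellCorner t k
  rw [zero_mul, zero_div, add_zero, sub_eq_add_neg, e1, e1, sum_filter_nonpos_eq_sum_min,
    sum_filter_neg_eq_sum_min, ← two_mul] at h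
  exact h

/-- **Lower half** at `U = 0`, any particle number `N ≤ 2L^d` (`L ≥ 3`):
`2 Σ_z min(ε_z, 0) ≤ E_L(N)(t, 0)` — the tree's bathtub bound at `μ = 0`.
[cite: LiebLoss1993, §8, Theorem 8.2] -/
theorem two_mul_sum_min_le_hubbardTorus_groundEnergyAt_zero (hL3 : 3 ≤ L) (t : ℝ) {N : ℕ}
    (hN : N ≤ 2 * L ^ d) :
    2 * ∑ z : TorusSite d L, min (sdwBand t (cellCorner z)) 0 ≤
      groundEnergyAt (fermionTorusGraph d L) t 0 N := by
  have h := hubbardTorus_groundEnergyAt_ge (d := d) hL3 t (le_refl (0 : ℝ)) 0 hN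
  simpa only [zero_mul, zero_add, sub_zero] using h

/-- **The half-filled free torus, exactly.** For `L ≥ 3` even, every `d` and every real `t`:
`E_L(L^d)(t, 0) = 2 Σ_{z ∈ (ℤ/Lℤ)^d} min(2tΣᵢcos (c_z)ᵢ, 0)` (twice the sum of the negative
plane-wave levels: "the ground state for the noninteracting system is obtained by filling the negative
energy states", Hirsch §II eq. (2.2); bathtub = Lieb–Loss §8).
[cite: Hirsch1985, §II, eq. (2.2)] [cite: LiebLoss1993, §8, Theorem 8.2] -/
theorem hubbardTorus_groundEnergyAt_zero_half_eq (hL3 : 3 ≤ L) (hL : Even L) (t : ℝ) :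
    groundEnergyAt (fermionTorusGraph d L) t 0 (L ^ d) =
      2 * ∑ z : TorusSite d L, min (sdwBand t (cellCorner z)) 0 :=
  le_antisymm (hubbardTorus_groundEnergyAt_zero_half_le hL3 hL t)
    (two_mul_sum_min_le_hubbardTorus_groundEnergyAt_zero hL3 t
      (Nat.le_mul_of_pos_left (L ^ d) Nat.zero_lt_two))

/-- The same value as minus the sum of the absolute levels: `E_L(L^d)(t, 0) = -Σ_z |2tΣᵢcos (c_z)ᵢ|`
(`L ≥ 3` even). [cite: LiebLoss1993, §8, Theorem 8.2] -/
theorem hubbardTorus_groundEnergyAt_zero_half_eq_neg_sum_abs (hL3 : 3 ≤ L) (hL : Even L) (t : ℝ) :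
    groundEnergyAt (fermionTorusGraph d L) t 0 (L ^ d) =
      -∑ z : TorusSite d L, |sdwBand t (cellCorner z)| := by
  rw [hubbardTorus_groundEnergyAt_zero_half_eq hL3 hL t, two_mul_sum_min_sdwBand_eq_neg_sum_abs hL t]

/-- Per site, the exact half-filled free energy of the even torus is a corner Riemann sum:
`E_L(L^d)(t,0)/L^d = 2 (2π)^{-d} · cornerRiemannSum (min(ε, 0)) L` (momentum sums of finite-volume
lattice fermions, Friedli–Velenik (10.41)). [cite: FriedliVelenikSMLS2017, §10.5.2] -/
theorem hubbardTorus_groundEnergyAt_zero_half_div_eq (hL3 : 3 ≤ L) (hL : Even L) (t : ℝ) :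
    groundEnergyAt (fermionTorusGraph d L) t 0 (L ^ d) / (L : ℝ) ^ d =
      2 * (((2 * Real.pi) ^ d)⁻¹ *
        cornerRiemannSum (fun p : Fin d → ℝ => min (sdwBand t p) 0) L) := by
  have h : (∑ z : TorusSite d L, min (sdwBand t (cellCorner z)) 0) / (L : ℝ) ^ d =
      ((2 * Real.pi) ^ d)⁻¹ * cornerRiemannSum (fun p : Fin d → ℝ => min (sdwBand t p) 0) L :=
    sum_cellCorner_div_eq (d := d) (L := L) (fun p : Fin d → ℝ => min (sdwBand t p) 0)
  rw [hubbardTorus_groundEnergyAt_zero_half_eq hL3 hL t, mul_div_assoc, h]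

end Torus

/-! ### §3 The thermodynamic limit at half filling: `e(t, 0, 1)` as a Brillouin-zone integral -/

/-- Lower half: `2 (2π)⁻² ∫_{[-π,π]²} min(ε(p), 0) dp ≤ e(t, 0, 1)` (the tree's free kinetic bound at
`μ = 0`). [cite: LiebLoss1993, §8, Theorem 8.2] -/
theorem integral_le_energyDensity2D_zero_one (t : ℝ) :
    2 * (((2 * Real.pi) ^ 2)⁻¹ * ∫ p in brillouin 2, min (sdwBand t p) 0) ≤ energyDensity2D t 0 1 := by
  have h := FreeKinetic.energyDensity2D_ge t (le_refl (0 : ℝ)) zero_le_one one_lt_two 0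
  simpa only [zero_mul, zero_add, sub_zero] using h

/-- Upper half at finite size: for every even `L ≥ 3`,
`e(t, 0, 1) ≤ 2 (2π)⁻² cornerRiemannSum(min(ε,0)) L + 16|t|/L` (tiling bound on the exactly solved
half-filled `L × L` torus). [cite: Ruelle1969, §3.3] -/
theorem energyDensity2D_zero_one_le_torus (t : ℝ) {L : ℕ} [NeZero L] (hL3 : 3 ≤ L) (hL : Even L) :
    energyDensity2D t 0 1 ≤
      2 * (((2 * Real.pi) ^ 2)⁻¹ * cornerRiemannSum (fun p : Fin 2 → ℝ => min (sdwBand t p) 0) L) +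
        16 * |t| / L := by
  obtain ⟨m, hm⟩ := hL
  have hL1 : 1 ≤ L := by omega
  have hm1 : 2 ≤ m := by omega
  have hmL : L * m < L * L := Nat.mul_lt_mul_of_pos_left (by omega) (by omega)
  have key := energyDensity2D_le t (le_refl (0 : ℝ)) hL1 (m := L * m) hmL
  have h2 : 2 * (L * m) = L * L := by
    rw [hm]
    ring
  have hLpos : (0 : ℝ) < L := by exact_mod_cast hL1
  have hdens : ((2 * (L * m) : ℕ) : ℝ) / (L : ℝ) ^ 2 = 1 := by
    rw [h2]
    push_cast
    field_simp
  rw [hdens, h2, ← groundEnergyAt_fermionTorusGraph_two, show L * L = L ^ 2 from (sq L).symm,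
    hubbardTorus_groundEnergyAt_zero_half_div_eq hL3 ⟨m, hm⟩ t] at key
  exact key

/-- `p ↦ min(ε(p), 0)` is continuous. [folklore] -/
private theorem continuous_min_sdwBand_zero {d : ℕ} (t : ℝ) :
    Continuous fun p : Fin d → ℝ => min (sdwBand t p) 0 :=
  (continuous_sdwBand t).min continuous_const

/-- Upper half in the limit: `e(t, 0, 1) ≤ 2 (2π)⁻² ∫_{[-π,π]²} min(ε(p), 0) dp` (even tori
`L = 2j + 4`, Riemann sums of the continuous `min(ε, 0)`, `16|t|/L → 0`).
[cite: FriedliVelenikSMLS2017, §10.5.2] -/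
theorem energyDensity2D_zero_one_le_integral (t : ℝ) :
    energyDensity2D t 0 1 ≤ 2 * (((2 * Real.pi) ^ 2)⁻¹ * ∫ p in brillouin 2, min (sdwBand t p) 0) := by
  set F : (Fin 2 → ℝ) → ℝ := fun p => min (sdwBand t p) 0 with hFdef
  have hF : ContinuousOn F (brillouin 2) := (continuous_min_sdwBand_zero t).continuousOn
  set φ : ℕ → ℕ := fun j => 2 * j + 4 with hφdef
  have hφ : Tendsto φ atTop atTop :=
    tendsto_atTop_atTop.2 fun b => ⟨b, fun j hj => by simp only [hφdef]; omega⟩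
  have hRS : Tendsto (fun j => 2 * (((2 * Real.pi) ^ 2)⁻¹ * cornerRiemannSum F (φ j)))
      atTop (𝓝 (2 * (((2 * Real.pi) ^ 2)⁻¹ * ∫ p in brillouin 2, F p))) :=
    (((tendsto_cornerRiemannSum hF).comp hφ).const_mul _).const_mul _
  have herr : Tendsto (fun j => 16 * |t| / ((φ j : ℕ) : ℝ)) atTop (𝓝 0) :=
    (tendsto_const_div_atTop_nhds_zero_nat (16 * |t|)).comp hφ
  have hsum := hRS.add herr
  rw [add_zero] at hsum
  refine ge_of_tendsto hsum (Eventually.of_forall fun j => ?_)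
  haveI : NeZero (φ j) := ⟨by simp only [hφdef]; omega⟩
  exact energyDensity2D_zero_one_le_torus t (L := φ j) (by simp only [hφdef]; omega)
    ⟨j + 2, by simp only [hφdef]; ring⟩

/-- **The half-filled free square lattice in the thermodynamic limit, integral form.** For every
real `t`: `e(t, 0, 1) = 2 (2π)⁻² ∫_{[-π,π]²} min(2t(cos p₁ + cos p₂), 0) dp` — the free Fermi sea
at `μ = 0` ("filling the negative energy states" of `ε_k = -2t(cos k_x + cos k_y)`, Hirsch §II
eq. (2.2), in the thermodynamic limit); the tree's bathtub lower bound and tiling upper bound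
coincide at `U = 0`. [cite: Hirsch1985, §II, eq. (2.2)] [cite: LiebLoss1993, §8, Theorem 8.2] -/
theorem energyDensity2D_zero_one_eq_integral (t : ℝ) :
    energyDensity2D t 0 1 = 2 * (((2 * Real.pi) ^ 2)⁻¹ * ∫ p in brillouin 2, min (sdwBand t p) 0) :=
  le_antisymm (energyDensity2D_zero_one_le_integral t) (integral_le_energyDensity2D_zero_one t)


/-! ### §4 The quadrature `∫_{[-π,π]²} min(cos x + cos y, 0) dx dy = -16` and the closed form
`e(t, 0, 1) = -16|t|/π²` -/

section Quadrature

open Real Set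

/-- `∫_u^v (c + cos y) dy = (v - u) c + (sin v - sin u)`. [folklore] -/
private theorem integral_const_add_cos (c u v : ℝ) :
    ∫ y in u..v, (c + Real.cos y) = (v - u) * c + (Real.sin v - Real.sin u) := by
  rw [intervalIntegral.integral_add intervalIntegrable_const
      (Real.continuous_cos.intervalIntegrable _ _),
    intervalIntegral.integral_const, integral_cos, smul_eq_mul]

/-- **Inner integral.** For `x ∈ [-π, π]`:
`∫_{-π}^{π} min(cos x + cos y, 0) dy = 2|x| cos x - 2 sin|x|` (the integrand is `cos x + cos y ≤ 0`
exactly on `|y| ≥ π - |x|`, and `0` is the minimum elsewhere). [folklore] -/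
private theorem integral_min_cos_add_cos {x : ℝ} (hx : x ∈ Icc (-π) π) :
    ∫ y in (-π)..π, min (Real.cos x + Real.cos y) 0 =
      2 * |x| * Real.cos x - 2 * Real.sin |x| := by
  have hxabs : |x| ≤ π := abs_le.mpr ⟨by linarith [hx.1], hx.2⟩
  set a : ℝ := π - |x| with ha
  have ha0 : 0 ≤ a := by linarith
  have haπ : a ≤ π := by linarith [abs_nonneg x]
  have hcosa : Real.cos a = -Real.cos x := by rw [ha, Real.cos_pi_sub, Real.cos_abs]
  have hsina : Real.sin a = Real.sin |x| := by rw [ha, Real.sin_pi_sub]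
  -- the two branches of the minimum
  have hout : ∀ y : ℝ, a ≤ |y| → |y| ≤ π →
      min (Real.cos x + Real.cos y) 0 = Real.cos x + Real.cos y := by
    intro y h1 h2
    apply min_eq_left
    have : Real.cos y ≤ Real.cos a := by
      rw [← Real.cos_abs y]
      exact Real.cos_le_cos_of_nonneg_of_le_pi ha0 h2 h1
    linarith
  have hin : ∀ y : ℝ, |y| ≤ a → min (Real.cos x + Real.cos y) 0 = 0 := by
    intro y h
    apply min_eq_right
    have : Real.cos a ≤ Real.cos y := by
      rw [← Real.cos_abs y]
      exact Real.cos_le_cos_of_nonneg_of_le_pi (abs_nonneg y) haπ h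
    linarith
  have hint : ∀ u v : ℝ,
      IntervalIntegrable (fun y => min (Real.cos x + Real.cos y) 0) volume u v := fun u v =>
    ((continuous_const.add Real.continuous_cos).min continuous_const).intervalIntegrable u v
  -- split `[-π, π]` at `-a` and `a`
  rw [← intervalIntegral.integral_add_adjacent_intervals (hint (-π) (-a)) (hint (-a) π),
    ← intervalIntegral.integral_add_adjacent_intervals (hint (-a) a) (hint a π)]
  have I1 : ∫ y in (-π)..(-a), min (Real.cos x + Real.cos y) 0 =
      (π - a) * Real.cos x - Real.sin a := by
    rw [intervalIntegral.integral_congr (g := fun y => Real.cos x + Real.cos y) ?_,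
      integral_const_add_cos, Real.sin_neg, Real.sin_neg, Real.sin_pi]
    · ring
    · intro y hy
      rw [Set.uIcc_of_le (by linarith)] at hy
      have hy0 : y ≤ 0 := by linarith [hy.2]
      exact hout y (by rw [abs_of_nonpos hy0]; linarith [hy.2])
        (by rw [abs_of_nonpos hy0]; linarith [hy.1])
  have I2 : ∫ y in (-a)..a, min (Real.cos x + Real.cos y) 0 = 0 := by
    rw [intervalIntegral.integral_congr (g := fun _ => (0 : ℝ)) ?_, intervalIntegral.integral_zero]
    intro y hy
    rw [Set.uIcc_of_le (by linarith)] at hy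
    exact hin y (abs_le.mpr ⟨hy.1, hy.2⟩)
  have I3 : ∫ y in a..π, min (Real.cos x + Real.cos y) 0 = (π - a) * Real.cos x - Real.sin a := by
    rw [intervalIntegral.integral_congr (g := fun y => Real.cos x + Real.cos y) ?_,
      integral_const_add_cos, Real.sin_pi]
    · ring
    · intro y hy
      rw [Set.uIcc_of_le haπ] at hy
      have hy0 : 0 ≤ y := le_trans ha0 hy.1
      exact hout y (by rw [abs_of_nonneg hy0]; exact hy.1) (by rw [abs_of_nonneg hy0]; exact hy.2)
  rw [I1, I2, I3, hsina, ha]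
  ring

/-- An antiderivative on `[0, π]`: `(2x sin x + 4 cos x)' = 2x cos x - 2 sin x`. [folklore] -/
private theorem hasDerivAt_outerPrimitive (x : ℝ) :
    HasDerivAt (fun x : ℝ => 2 * x * Real.sin x + 4 * Real.cos x)
      (2 * x * Real.cos x - 2 * Real.sin x) x := by
  have ha : HasDerivAt (fun y : ℝ => 2 * y) 2 x := by
    simpa using (hasDerivAt_id x).const_mul (2 : ℝ)
  have h1 : HasDerivAt (fun y : ℝ => 2 * y * Real.sin y)
      (2 * Real.sin x + 2 * x * Real.cos x) x := ha.mul (Real.hasDerivAt_sin x)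
  have h2 : HasDerivAt (fun y : ℝ => 4 * Real.cos y) (4 * -Real.sin x) x :=
    (Real.hasDerivAt_cos x).const_mul 4
  refine (h1.add h2).congr_deriv ?_
  ring

/-- **Outer integral**: `∫_{-π}^{π} (2|x| cos x - 2 sin|x|) dx = -16` (the integrand is even; on
`[0, π]` an antiderivative is `2x sin x + 4 cos x`, giving `-8` on each half). [folklore] -/
private theorem integral_outer_eq : ∫ x in (-π)..π, (2 * |x| * Real.cos x - 2 * Real.sin |x|) = -16 := by
  have hint : ∀ u v : ℝ,
      IntervalIntegrable (fun x => 2 * |x| * Real.cos x - 2 * Real.sin |x|) volume u v := fun u v =>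
    (((continuous_const.mul continuous_abs).mul Real.continuous_cos).sub
      (continuous_const.mul (Real.continuous_sin.comp continuous_abs))).intervalIntegrable u v
  have hcint : ∀ u v : ℝ,
      IntervalIntegrable (fun x => 2 * x * Real.cos x - 2 * Real.sin x) volume u v := fun u v =>
    (((continuous_const.mul continuous_id).mul Real.continuous_cos).sub
      (continuous_const.mul Real.continuous_sin)).intervalIntegrable u v
  rw [← intervalIntegral.integral_add_adjacent_intervals (hint (-π) 0) (hint 0 π)]
  have Ipos : ∫ x in (0 : ℝ)..π, (2 * |x| * Real.cos x - 2 * Real.sin |x|) = -8 := by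
    rw [intervalIntegral.integral_congr (g := fun x => 2 * x * Real.cos x - 2 * Real.sin x) ?_,
      intervalIntegral.integral_eq_sub_of_hasDerivAt (fun x _ => hasDerivAt_outerPrimitive x)
        (hcint 0 π)]
    · simp only [Real.sin_pi, Real.cos_pi, Real.sin_zero, Real.cos_zero]
      ring
    · intro x hx
      rw [Set.uIcc_of_le Real.pi_pos.le] at hx
      simp only [abs_of_nonneg hx.1]
  have Ineg : ∫ x in (-π)..(0 : ℝ), (2 * |x| * Real.cos x - 2 * Real.sin |x|) = -8 := by
    rw [intervalIntegral.integral_congr (g := fun x => -(2 * x * Real.cos x - 2 * Real.sin x)) ?_,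
      intervalIntegral.integral_neg,
      intervalIntegral.integral_eq_sub_of_hasDerivAt (fun x _ => hasDerivAt_outerPrimitive x)
        (hcint (-π) 0)]
    · simp only [Real.sin_pi, Real.cos_pi, Real.sin_zero, Real.cos_zero, Real.sin_neg, Real.cos_neg,
        mul_zero, neg_zero, mul_neg]
      ring
    · intro x hx
      rw [Set.uIcc_of_le (by linarith [Real.pi_pos])] at hx
      simp only [abs_of_nonpos hx.2, Real.sin_neg]
      ring
  rw [Ipos, Ineg]
  norm_num

/-- The Brillouin zone of `ℤ²` is the preimage of the square under `p ↦ (p 0, p 1)`. [folklore] -/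
private theorem brillouin_two_eq_preimage_square :
    brillouin 2 = (MeasurableEquiv.finTwoArrow : (Fin 2 → ℝ) ≃ᵐ ℝ × ℝ) ⁻¹'
      (Icc (-π) π ×ˢ Icc (-π) π) := by
  ext p
  simp only [brillouin, Set.mem_pi, Set.mem_univ, true_implies, Set.mem_preimage, Set.mem_prod]
  exact ⟨fun h => ⟨h 0, h 1⟩, fun h i => by fin_cases i <;> [exact h.1; exact h.2]⟩

/-- A Brillouin-zone integral over `[-π,π]²` as an integral over the square in `ℝ × ℝ`.
[folklore] -/
private theorem integral_brillouin_two_eq_integral_square (g : ℝ × ℝ → ℝ) :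
    ∫ p in brillouin 2, g (p 0, p 1) = ∫ q in Icc (-π) π ×ˢ Icc (-π) π, g q := by
  have h := (volume_preserving_finTwoArrow ℝ).setIntegral_preimage_emb
    (MeasurableEquiv.finTwoArrow : (Fin 2 → ℝ) ≃ᵐ ℝ × ℝ).measurableEmbedding g
    (Icc (-π) π ×ˢ Icc (-π) π)
  rw [← brillouin_two_eq_preimage_square] at h
  exact h

/-- Fubini on the square for a continuous integrand, with interval integrals. [folklore] -/
private theorem integral_square_eq_iterated {g : ℝ × ℝ → ℝ} (hg : Continuous g) :
    ∫ q in Icc (-π) π ×ˢ Icc (-π) π, g q = ∫ x in (-π)..π, ∫ y in (-π)..π, g (x, y) := by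
  have hππ : -π ≤ π := by linarith [Real.pi_pos]
  rw [Measure.volume_eq_prod, setIntegral_prod g
      (hg.continuousOn.integrableOn_compact (isCompact_Icc.prod isCompact_Icc)),
    intervalIntegral.integral_of_le hππ, ← integral_Icc_eq_integral_Ioc]
  refine setIntegral_congr_fun measurableSet_Icc fun x _ => ?_
  rw [intervalIntegral.integral_of_le hππ, ← integral_Icc_eq_integral_Ioc]

/-- `∫_{[-π,π]²} (cos x + cos y) dx dy = 0`. [folklore] -/
private theorem integral_square_cos_add_cos :
    ∫ q in Icc (-π) π ×ˢ Icc (-π) π, (Real.cos q.1 + Real.cos q.2) = 0 := by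
  rw [integral_square_eq_iterated (by fun_prop)]
  dsimp only
  have hinner : ∀ x : ℝ, ∫ y in (-π)..π, (Real.cos x + Real.cos y) = 2 * π * Real.cos x := by
    intro x
    rw [integral_const_add_cos, Real.sin_neg, Real.sin_pi]
    ring
  simp_rw [hinner]
  rw [intervalIntegral.integral_const_mul, integral_cos, Real.sin_neg, Real.sin_pi]
  ring

/-- **`∫_{[-π,π]²} min(cos x + cos y, 0) dx dy = -16`.** [folklore] -/
private theorem integral_square_min_cos_add_cos :
    ∫ q in Icc (-π) π ×ˢ Icc (-π) π, min (Real.cos q.1 + Real.cos q.2) 0 = -16 := by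
  rw [integral_square_eq_iterated (by fun_prop)]
  dsimp only
  rw [intervalIntegral.integral_congr (g := fun x => 2 * |x| * Real.cos x - 2 * Real.sin |x|) ?_,
    integral_outer_eq]
  intro x hx
  rw [Set.uIcc_of_le (by linarith [Real.pi_pos])] at hx
  exact integral_min_cos_add_cos hx

/-- Pointwise: `min(2ts, 0) = t s - |t| (s - 2 min(s, 0))` (`= t s - |t||s|`). [folklore] -/
private theorem min_two_mul_eq (t s : ℝ) : min (t * (2 * s)) 0 = t * s - |t| * (s - 2 * min s 0) := by
  rcases le_total 0 s with hs | hs <;> rcases le_total 0 t with ht | ht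
  · rw [min_eq_right (by positivity), min_eq_right hs, abs_of_nonneg ht]; ring
  · rw [abs_of_nonpos ht, min_eq_right hs, min_eq_left (by nlinarith)]; ring
  · rw [abs_of_nonneg ht, min_eq_left hs, min_eq_left (by nlinarith)]; ring
  · rw [abs_of_nonpos ht, min_eq_left hs, min_eq_right (by nlinarith)]; ring

/-- **`∫_{[-π,π]²} min(2t(cos p₁ + cos p₂), 0) dp = -32|t|`.** [folklore] -/
private theorem integral_brillouin_two_min_sdwBand (t : ℝ) :
    ∫ p in brillouin 2, min (sdwBand t p) 0 = -(32 * |t|) := by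
  set G : ℝ × ℝ → ℝ := fun q => t * (Real.cos q.1 + Real.cos q.2) -
      |t| * ((Real.cos q.1 + Real.cos q.2) - 2 * min (Real.cos q.1 + Real.cos q.2) 0) with hG
  have hpt : ∀ p : Fin 2 → ℝ, min (sdwBand t p) 0 = G (p 0, p 1) := by
    intro p
    simp only [hG, sdwBand, Fin.sum_univ_two]
    exact min_two_mul_eq t _
  simp_rw [hpt]
  rw [integral_brillouin_two_eq_integral_square G]
  simp only [hG]
  have hK : IsCompact (Icc (-π) π ×ˢ Icc (-π) π) := isCompact_Icc.prod isCompact_Icc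
  have hs : IntegrableOn (fun q : ℝ × ℝ => Real.cos q.1 + Real.cos q.2) (Icc (-π) π ×ˢ Icc (-π) π) :=
    (Continuous.continuousOn (by fun_prop)).integrableOn_compact hK
  have hm : IntegrableOn (fun q : ℝ × ℝ => min (Real.cos q.1 + Real.cos q.2) 0)
      (Icc (-π) π ×ˢ Icc (-π) π) :=
    (Continuous.continuousOn (by fun_prop)).integrableOn_compact hK
  have h1 : IntegrableOn (fun q : ℝ × ℝ => t * (Real.cos q.1 + Real.cos q.2)) (Icc (-π) π ×ˢ Icc (-π) π) :=
    hs.const_mul t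
  have h2 : IntegrableOn (fun q : ℝ × ℝ =>
      |t| * ((Real.cos q.1 + Real.cos q.2) - 2 * min (Real.cos q.1 + Real.cos q.2) 0))
      (Icc (-π) π ×ˢ Icc (-π) π) := (hs.sub (hm.const_mul 2)).const_mul |t|
  rw [integral_sub h1 h2, integral_const_mul, integral_const_mul, integral_sub hs (hm.const_mul 2),
    integral_const_mul, integral_square_cos_add_cos, integral_square_min_cos_add_cos]
  ring

end Quadrature

/-- **The half-filled free square lattice: `e(t, 0, 1) = -16|t|/π²`** (`≈ -1.6211 |t|`; the
two-dimensional analogue of the chain value `-4|t|/π` [cite: LiebWuPhysicaA2003, §6]) — the energy of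
the filled negative-energy plane waves `ε_k = -2t(cos k_x + cos k_y)` of Hirsch §II eq. (2.2) in the
thermodynamic limit, evaluated in closed form (§4). For every real `t`. [cite: Hirsch1985, §II, eq. (2.2)] -/
theorem energyDensity2D_zero_one (t : ℝ) : energyDensity2D t 0 1 = -(16 * |t|) / Real.pi ^ 2 := by
  rw [energyDensity2D_zero_one_eq_integral, integral_brillouin_two_min_sdwBand]
  have hπ : Real.pi ≠ 0 := Real.pi_ne_zero
  field_simp
  ring

/-- The cell's normalisation `t = 1`: `e(1, 0, 1) = -16/π²` (filled negative-energy plane waves of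
Hirsch §II eq. (2.2), closed form). [cite: Hirsch1985, §II, eq. (2.2)] -/
theorem energyDensity2D_one_zero_one : energyDensity2D 1 0 1 = -16 / Real.pi ^ 2 := by
  rw [energyDensity2D_zero_one, abs_one, mul_one]

/-- Numerical enclosure of the `t = 1` value: `-1.6212 < e(1, 0, 1) < -1.6211`
(`π² ∈ (9.8695, 9.8697)`; the `U = 0` control value of the cell's square-lattice tables).
[cite: Hirsch1985, §II, eq. (2.2)] -/
theorem energyDensity2D_one_zero_one_mem_Ioo :
    energyDensity2D 1 0 1 ∈ Set.Ioo (-1.6212 : ℝ) (-1.6211) := by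
  rw [energyDensity2D_one_zero_one, Set.mem_Ioo]
  have h1 : (3.14159 : ℝ) < Real.pi := by linarith [Real.pi_gt_d6]
  have h2 : Real.pi < 3.1416 := Real.pi_lt_d4
  have hπ2lo : (9.8695 : ℝ) < Real.pi ^ 2 := by nlinarith
  have hπ2hi : Real.pi ^ 2 < (9.8697 : ℝ) := by nlinarith [Real.pi_pos]
  have hpos : (0 : ℝ) < Real.pi ^ 2 := by positivity
  constructor
  · rw [lt_div_iff₀ hpos]; nlinarith
  · rw [div_lt_iff₀ hpos]; nlinarith

end FreeFermionSquare

end Literature.MathematicalPhysics.QuantumLattice
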